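import Literature.MathematicalPhysics.QuantumFieldTheory.Balaban1983to89.HaarExponentialChartCocycle
import Literature.MathematicalPhysics.QuantumFieldTheory.Balaban1983to89.HaarExpChartChangeOfVariablesPiInverse
import HarnessLib

/-!
# BalabanUVNodes ∕ N09 — TOOLS FOR THE GLOBAL FORWARD JACOBIAN LAW OF THE (0.4) FIBRE MAP: the exponential chart is non-degenerate on its whole ball, its transition maps
# have non-degenerate derivative, and forward laws `μ⌊E(S) = E_*(J·μ⌊S)` transport under translations

Cell `pub-ymgap` (YM-PLAN Track A), width seat `pub-ymgap-dag-n09-w4` g5 (FILE 7 = INTENT-6a); count-neutral helper of K1⁹ `StabilityBRunRowsAtRecordR13SepCoPHV` =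
stmt-QuantumFields-27364 (`--supports`, `--as helper`).  Generic tools for the located piece (F) of dag-n09-w6's private-coordinate road to `hreg` (the forward Jacobian
law of `g ↦ Ū(U[β(c) ↦ g])(c)` on the central `α`-window), used by `…N09CentralWindowForwardLaw` and `…N09CentralWindowNondegenerate`.

WHAT IS PROVED (0 def, 0 sorry).  §1 `norm_adg_le` (`‖ad_𝔤 x‖ ≤ 2‖x‖`) · `isUnit_jac_of_norm_le_half` ([Balaban1985Averaging] (34): `g(T)` is a unit for `‖T‖ ≤ 1`) ·
★ `det_jac_ne_zero_of_norm_le_half` — `det jac(x) ≠ 0` for `‖x‖ ≤ 1∕2`, hence on the WHOLE chart ball (`s_C ≤ r_C ≤ 1∕2`; the tree's `exists_ball_det_jac_pos` was only `∃ s₀`).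
§2 ★ `differentiableAt_transition_and_det_ne_zero` — the transition maps `T_k = Λ ∘ (k·) ∘ Θ` are differentiable with `det DT_k(X) ≠ 0` (p28's cocycle `jac(T_k X) ∘ DT_k(X) = jac(X)`).
§3 `restrict_image_mulLeft_eq_map` · ★ `forwardLaw_of_forwardLaw_at_one` (a law for `Ψ₁(k) = e⁻¹E(bk)` on `b⁻¹S` gives the law for `E` on `S` with density `J₁(b⁻¹W)`, left-invariant `μ`) ·
★ `forwardLaw_comp_mul_mul` (a law for `E` on `S` gives the law for `g ↦ E(p·g·q)` on `{g | p·g·q ∈ S}` with density `J(p·g·q)`, bi-invariant `μ`).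

HONEST FRAMING.  Count-neutral; classical Lie-group chart calculus ∕ change of variables BY NAME on the tree's typed (0.4) objects; nothing of Bałaban's estimates asserted;
`hreg` NOT discharged; N09 NOT discharged; conjunct 1 (Lemma 4) ∕ FLAG №7 untouched; K0⁷ ∕ K1⁹ ∕ K3⁸ NOT closed; counts unmoved; one finite four-torus programme at fixed
`ε = L^{−K}` — R4 closes the conditional rung `BalabanLadder.UV` only; NOT ℝ⁴ ∕ infinite volume ∕ OS; the Yang–Mills mass gap (Clay) is NOT proved by any of this.
-/

noncomputable section

open scoped Topology ENNReal
open Filter Set Function MeasureTheory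

namespace Summit.QuantumFields.YangMills.BalabanUVNodes.N09ForwardLawTools

open Literature.MathematicalPhysics.QuantumFieldTheory.Balaban1983to89
open Literature.MathematicalPhysics.QuantumFieldTheory.Balaban1983to89.HaarExponentialChart
open Literature.MathematicalPhysics.QuantumFieldTheory.Balaban1983to89.HaarExponentialChart.IsChartRep
open Literature.MathematicalPhysics.QuantumFieldTheory.Balaban1983to89.B13HaarSigmaJacobian (jac adg)
open Literature.Analysis.Calculus.ExpDifferential (gSer isUnit_gSer)

/-! ## §1  `det jac(x) ≠ 0` on `‖x‖ ≤ 1∕2` — hence on the whole chart ball (`s_C ≤ r_C ≤ 1∕2`) -/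

section Jac

variable {𝔸 : Type*} [NormedRing 𝔸] [NormedAlgebra ℝ 𝔸]
variable {𝔤 : Submodule ℝ 𝔸} [FiniteDimensional ℝ 𝔤]
  (hlie : ∀ x ∈ 𝔤, ∀ y ∈ 𝔤, x * y - y * x ∈ 𝔤)

/-- `‖ad_𝔤 x‖ ≤ 2‖x‖`. [cite: Helgason2000, Ch. I §1 Thm. 1.14 (12) p. 96] -/
theorem norm_adg_le (x : 𝔤) : ‖adg hlie x‖ ≤ 2 * ‖x‖ := by
  refine ContinuousLinearMap.opNorm_le_bound _ (by positivity) fun y => ?_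
  rw [← Submodule.norm_coe, B13HaarSigmaJacobian.adg_apply_coe]
  calc ‖(x : 𝔸) * y - y * x‖ ≤ ‖(x : 𝔸) * y‖ + ‖(y : 𝔸) * x‖ := norm_sub_le _ _
    _ ≤ ‖(x : 𝔸)‖ * ‖(y : 𝔸)‖ + ‖(y : 𝔸)‖ * ‖(x : 𝔸)‖ := add_le_add (norm_mul_le _ _) (norm_mul_le _ _)
    _ = 2 * ‖x‖ * ‖y‖ := by rw [Submodule.norm_coe, Submodule.norm_coe]; ring

/-- **`jac x` is invertible for `‖x‖ ≤ 1∕2`** (`‖ad_𝔤 x‖ ≤ 1` and [Balaban1985Averaging] (34): `g(T)` is a unit for `‖T‖ ≤ 1`).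
[cite: Balaban1985Averaging, (34) p.23] [cite: Helgason2000, Ch. I §1 Thm. 1.14 (12) p. 96] -/
theorem isUnit_jac_of_norm_le_half {x : 𝔤} (hx : ‖x‖ ≤ 1 / 2) : IsUnit (jac hlie x) := by
  haveI : CompleteSpace 𝔤 := FiniteDimensional.complete ℝ 𝔤
  have h1 : ‖adg hlie x‖ ≤ 1 := (norm_adg_le hlie x).trans (by linarith)
  exact isUnit_gSer (𝕂 := ℝ) h1

/-- **`det jac(x) ≠ 0` for `‖x‖ ≤ 1∕2`** — in particular on the whole chart ball `‖x‖ < s_C` (`s_C ≤ r_C ≤ 1∕2`).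
[cite: Helgason2000, Ch. I §1 Thm. 1.14 (12) p. 96] [cite: Balaban1985Averaging, (34) p.23] -/
theorem det_jac_ne_zero_of_norm_le_half {x : 𝔤} (hx : ‖x‖ ≤ 1 / 2) :
    LinearMap.det (jac hlie x : 𝔤 →ₗ[ℝ] 𝔤) ≠ 0 := by
  obtain ⟨u, hu⟩ := isUnit_jac_of_norm_le_half hlie hx
  have h0 : jac hlie x * ((u⁻¹ : (𝔤 →L[ℝ] 𝔤)ˣ) : 𝔤 →L[ℝ] 𝔤) = 1 := by rw [← hu]; exact Units.mul_inv u
  have h1 : ((jac hlie x : 𝔤 →L[ℝ] 𝔤) : 𝔤 →ₗ[ℝ] 𝔤) ∘ₗ (((u⁻¹ : (𝔤 →L[ℝ] 𝔤)ˣ) : 𝔤 →L[ℝ] 𝔤) : 𝔤 →ₗ[ℝ] 𝔤) = LinearMap.id :=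
    congrArg (fun T : 𝔤 →L[ℝ] 𝔤 => (T : 𝔤 →ₗ[ℝ] 𝔤)) h0
  have h2 := congrArg LinearMap.det h1
  rw [LinearMap.det_comp, LinearMap.det_id] at h2
  exact left_ne_zero_of_mul_eq_one h2

end Jac

/-! ## §2  The transition maps of the chart have non-degenerate derivative -/

section Transition

variable {𝔸 : Type*} [NormedRing 𝔸] [NormedAlgebra ℂ 𝔸] [CompleteSpace 𝔸]
variable {G : Type*} [Group G] [TopologicalSpace G]
variable {C : LogChart 𝔸} {ρ : G →* 𝔸} (h : IsChartRep C ρ) [FiniteDimensional ℝ C.lie]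
  (hlie : ∀ x ∈ C.lie, ∀ y ∈ C.lie, x * y - y * x ∈ C.lie)

include h hlie in
/-- **The transition map `T_k = Λ ∘ (k·) ∘ Θ` is differentiable with `det DT_k(X) ≠ 0`** at every `X` of the chart ball with `k·Θ X ∈ V_{s_C}`: the cocycle
`jac(T_k X) ∘ DT_k(X) = jac(X)` of `HaarExponentialChartCocycle.hasFDerivAt_transition` and `det jac(X) ≠ 0` on the chart ball.
[cite: Helgason2000, Ch. I §1 Thm. 1.14 (12) p. 96] -/
theorem differentiableAt_transition_and_det_ne_zero {k : G} {X : C.lie} (hX : ‖X‖ < chartRadius C)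
    (hkX : k * h.expChart X ∈ h.window (chartRadius C)) :
    DifferentiableAt ℝ (h.transition k) X ∧ (fderiv ℝ (h.transition k) X).det ≠ 0 := by
  obtain ⟨L, hL, hcocycle⟩ := h.hasFDerivAt_transition hlie le_rfl hkX
  refine ⟨hL.differentiableAt, ?_⟩
  rw [hL.fderiv]
  have hXhalf : ‖X‖ ≤ 1 / 2 := (hX.le.trans chartRadius_le_innerRadius).trans innerRadius_le_half
  have hdet : LinearMap.det (jac hlie (h.transition k X) : C.lie →ₗ[ℝ] C.lie) * LinearMap.det (L : C.lie →ₗ[ℝ] C.lie) =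
      LinearMap.det (jac hlie X : C.lie →ₗ[ℝ] C.lie) := by
    rw [← LinearMap.det_comp]
    exact congrArg (fun T : C.lie →L[ℝ] C.lie => LinearMap.det (T : C.lie →ₗ[ℝ] C.lie)) hcocycle
  intro h0
  have h0' : LinearMap.det (L : C.lie →ₗ[ℝ] C.lie) = 0 := h0
  rw [h0', mul_zero] at hdet
  exact det_jac_ne_zero_of_norm_le_half hlie hXhalf hdet.symm

end Transition

/-! ## §3  Transport of forward laws `μ⌊E(S) = E_*(J·μ⌊S)` under translations of a unimodular group -/

section Transport

variable {G : Type*} [Group G] [MeasurableSpace G] [MeasurableMul G]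

/-- Bookkeeping: a left translation carries a restricted left-invariant measure onto the restriction to the translated set. [cite: Balaban1985Averaging, (10) p.19 (bookkeeping)] -/
theorem restrict_image_mulLeft_eq_map (μ : Measure G) [μ.IsMulLeftInvariant] (u : G) (S : Set G) :
    μ.restrict ((fun k : G => u * k) '' S) = Measure.map (fun k : G => u * k) (μ.restrict S) := by
  have he : ((fun k : G => u * k)) = (MeasurableEquiv.mulLeft u : G → G) := rfl
  have hpre : (fun k : G => u * k) ⁻¹' ((fun k : G => u * k) '' S) = S :=
    (MeasurableEquiv.mulLeft u).injective.preimage_image S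
  conv_lhs => rw [← map_mul_left_eq_self μ u]
  rw [he, (MeasurableEquiv.mulLeft u).measurableEmbedding.restrict_map, ← he, hpre]

/-- **TRANSPORT OF A FORWARD LAW FROM THE IDENTITY**: if `Ψ₁(k) = e⁻¹·E(b·k)` satisfies `μ⌊Ψ₁(b⁻¹S) = Ψ₁_*(J₁·μ⌊b⁻¹S)` for a left-invariant `μ`, then
`μ⌊E(S) = E_*(J·μ⌊S)` with `J(W) = J₁(b⁻¹W)`. [cite: Balaban1987RG1, (2.10) p.267 (bookkeeping); Balaban1985Averaging, (10) p.19] -/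
theorem forwardLaw_of_forwardLaw_at_one (μ : Measure G) [μ.IsMulLeftInvariant] {E Ψ₁ : G → G} (b e : G) {S : Set G}
    (J₁ : G → ℝ≥0∞) (hΨ₁ : ∀ k, Ψ₁ k = e⁻¹ * E (b * k)) (hE : Measurable E)
    (hlaw : μ.restrict (Ψ₁ '' ((fun W : G => b⁻¹ * W) '' S)) =
      Measure.map Ψ₁ ((μ.restrict ((fun W : G => b⁻¹ * W) '' S)).withDensity J₁)) :
    μ.restrict (E '' S) = Measure.map E ((μ.restrict S).withDensity fun W => J₁ (b⁻¹ * W)) := by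
  have hΨm : Measurable Ψ₁ := by
    have : Ψ₁ = fun k => e⁻¹ * E (b * k) := funext hΨ₁
    rw [this]; exact (hE.comp (measurable_const_mul b)).const_mul _
  -- `E '' S = e · Ψ₁ '' (b⁻¹ S)`
  have hES : E '' S = (fun k : G => e * k) '' (Ψ₁ '' ((fun W : G => b⁻¹ * W) '' S)) := by
    rw [Set.image_image, Set.image_image]
    refine Set.image_congr' fun W => ?_
    show E W = e * Ψ₁ (b⁻¹ * W)
    rw [hΨ₁, mul_inv_cancel_left, mul_inv_cancel_left]
  rw [hES, restrict_image_mulLeft_eq_map μ e, hlaw, Measure.map_map (measurable_const_mul e) hΨm,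
    restrict_image_mulLeft_eq_map μ b⁻¹]
  have he : ((fun W : G => b⁻¹ * W)) = (MeasurableEquiv.mulLeft b⁻¹ : G → G) := rfl
  have hdens : (Measure.map (fun W : G => b⁻¹ * W) (μ.restrict S)).withDensity J₁ =
      Measure.map (fun W : G => b⁻¹ * W) ((μ.restrict S).withDensity fun W => J₁ (b⁻¹ * W)) := by
    have hJ : (fun W : G => J₁ (b⁻¹ * W)) = J₁ ∘ (MeasurableEquiv.mulLeft b⁻¹ : G → G) := rfl
    rw [he, hJ, map_withDensity_measurableEquiv]
    congr 1
    funext W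
    simp only [Function.comp_apply, MeasurableEquiv.apply_symm_apply]
  rw [hdens, Measure.map_map ((measurable_const_mul e).comp hΨm) (measurable_const_mul b⁻¹)]
  congr 1
  funext W
  show e * Ψ₁ (b⁻¹ * W) = E W
  rw [hΨ₁, mul_inv_cancel_left, mul_inv_cancel_left]

/-- **TRANSPORT OF A FORWARD LAW UNDER A BI-TRANSLATION OF THE VARIABLE**: if `μ⌊E(S) = E_*(J·μ⌊S)` and `μ` is invariant under `g ↦ p·g·q`, then for
`F(g) = E(p·g·q)` and the window `{g | p·g·q ∈ S}`: `μ⌊F(window) = F_*((J(p·g·q))·μ⌊window)`.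
[cite: Balaban1987RG1, (0.4) p.253 and (2.10) p.267 (bookkeeping); Balaban1985Averaging, (10) p.19] -/
theorem forwardLaw_comp_mul_mul (μ : Measure G) [μ.IsMulLeftInvariant] [μ.IsMulRightInvariant] {E : G → G} (p q : G)
    {S : Set G} (J : G → ℝ≥0∞) (hE : Measurable E)
    (hlaw : μ.restrict (E '' S) = Measure.map E ((μ.restrict S).withDensity J)) :
    μ.restrict ((fun g : G => E (p * g * q)) '' {g : G | p * g * q ∈ S}) =
      Measure.map (fun g : G => E (p * g * q)) ((μ.restrict {g : G | p * g * q ∈ S}).withDensity fun g => J (p * g * q)) := by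
  set m : G ≃ᵐ G := (MeasurableEquiv.mulRight q).trans (MeasurableEquiv.mulLeft p) with hm
  have hmf : (m : G → G) = fun g => p * g * q := by
    funext g; simp only [hm, MeasurableEquiv.trans_apply, MeasurableEquiv.coe_mulRight, MeasurableEquiv.coe_mulLeft, mul_assoc]
  have hμm : Measure.map m μ = μ := by
    have hsplit : (fun g : G => p * g * q) = (fun g : G => p * g) ∘ (fun g : G => g * q) := by
      funext g; simp only [Function.comp_apply, mul_assoc]
    rw [hmf, hsplit, ← Measure.map_map (measurable_const_mul p) (measurable_mul_const q), map_mul_right_eq_self,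
      map_mul_left_eq_self]
  have hwin : {g : G | p * g * q ∈ S} = m ⁻¹' S := by
    ext g; simp only [Set.mem_setOf_eq, Set.mem_preimage, hmf]
  have hF : (fun g : G => E (p * g * q)) = E ∘ m := by rw [hmf]; rfl
  have hFS : (fun g : G => E (p * g * q)) '' {g : G | p * g * q ∈ S} = E '' S := by
    rw [hwin, hF, Set.image_comp, Set.image_preimage_eq S m.surjective]
  rw [hFS, hlaw, hF, hwin, ← Measure.map_map hE m.measurable]
  congr 1
  -- `map m ((μ⌊m⁻¹S).withDensity (J ∘ m)) = (μ⌊S).withDensity J`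
  have h1 : Measure.map m (μ.restrict (m ⁻¹' S)) = μ.restrict S := by
    rw [← m.measurableEmbedding.restrict_map, hμm]
  have hJm : (fun g => J (p * g * q)) = J ∘ m := by rw [hmf]; rfl
  rw [hJm, map_withDensity_measurableEquiv, h1]
  congr 1
  funext W
  show J W = J (m (m.symm W))
  rw [m.apply_symm_apply]

end Transport

end Summit.QuantumFields.YangMills.BalabanUVNodes.N09ForwardLawTools
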